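import Summits.Ventures.HSemireg.ObstructionLocusPartialBranchTuples

/-!
# Venture HSemireg — (S5) OBSTRUCTION LOCUS away from secant type, XLV: COUNTING the partial branch tuples — the
# number of pieces of `Ext^q_R(I_M, I_M)` (file XLIV): the Pascal-type recursion along one block and the closed
# form `C(r, q) · 2^q` for pair blocks

HONEST FRAMING.  Part of the Lean side of the computation cell `pub-hsemireg` (track «S4-PUSH» (ii), seat
s4-prove-2).  Finite combinatorics on top of file XLIII (`PBT B q`, `pbtSplit`, `brProdEquiv`) and file XIX
(`card_branch`).  Nothing here constructs a variety or a sheaf; nothing here says that HC / HC_CM / HC_AV holds; no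
Literature fact is declared or used; no object is certified.

CONTENT.  `card_br` (`|S|(|S| − 1)` branch data per block), **`card_pbt_succ`** ∕ **`card_pbt_zero`** (the recursion
`#PBT(M, k+1) = #PBT(M′, k+1) + |S_{i₀}|(|S_{i₀}| − 1) · #PBT(M′, k)`, `#PBT(M, 0) = #PBT(M′, 0)`), and
**`card_pbt_of_card_eq_two`**: for PAIR blocks (the point type `K₂ ⊔ ⋯ ⊔ K₂` of every crossing point of a (GEN) design
in `E^{2m}`) `#PBT(M, q) = C(r, q) · 2^q` — with file XLIV, `Ext^q_R(I_M, I_M)` at such a point is a product of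
`C(r, q) · 2^q` coordinate rings of codimension-`2q` coordinate subspaces (`1, 6, 12, 8` for `q = 0, …, 3` at the triple
point of `E⁶`; EXT-NOTE §6.D's stalk numbers); and THE GENERAL CLOSED FORM **`card_pbt`**: `#PBT(M, q) =
Σ_{J ⊆ blocks, |J| = q} Π_{i ∈ J} |S_i|(|S_i| − 1)` — the `q`-th elementary symmetric function of the block weights
(`card_pbt_eq_esymm`, via Mathlib's `Multiset.esymm` and the recursion `esymm_univ_succ`).
References (dictionary only): EXT-NOTE.md §6.B(c), §6.D.
-/

open Finset
open scoped BigOperators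

universe u

namespace Summit.Ventures.HSemireg.ObstructionLocus.BlockModel

variable {n : ℕ}

section Count

variable {ι : Type} [Fintype ι] [DecidableEq ι] (B : Blocks ι n) (i₀ : ι)

omit [Fintype ι] [DecidableEq ι] in
/-- A block contributes `|S|(|S| − 1)` branch data (file XIX's `card_branch`). -/
theorem card_br (i : ι) : Fintype.card (Br B i) = (B.S i).card * ((B.S i).card - 1) := by
  rw [card_branch]
  simp [Blocks.single]

/-- **The recursion in degree `k + 1`**: `#PBT(M, k+1) = #PBT(M′, k+1) + |S_{i₀}|(|S_{i₀}| − 1) · #PBT(M′, k)`. -/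
theorem card_pbt_succ (k : ℕ) :
    Fintype.card (PBT B (k + 1)) =
      Fintype.card (PBT (B.restrict (· ≠ i₀)) (k + 1)) +
        (B.S i₀).card * ((B.S i₀).card - 1) * Fintype.card (PBT (B.restrict (· ≠ i₀)) k) := by
  rw [Fintype.card_congr (pbtSplit B i₀ (k + 1)), Fintype.card_sum, Fintype.card_congr (brProdEquiv B i₀ k),
    Fintype.card_prod, card_br]

/-- **The recursion in degree `0`**: `#PBT(M, 0) = #PBT(M′, 0)`. -/
theorem card_pbt_zero :
    Fintype.card (PBT B 0) = Fintype.card (PBT (B.restrict (· ≠ i₀)) 0) := by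
  haveI : IsEmpty {p : Br B i₀ × PTuple (B.restrict (· ≠ i₀)) // pdeg (B.restrict (· ≠ i₀)) p.2 + 1 = 0} :=
    Subtype.isEmpty_of_false fun p h => by omega
  rw [Fintype.card_congr (pbtSplit B i₀ 0), Fintype.card_sum,
    Fintype.card_eq_zero
      (α := {p : Br B i₀ × PTuple (B.restrict (· ≠ i₀)) // pdeg (B.restrict (· ≠ i₀)) p.2 + 1 = 0}),
    add_zero]

end Count

/-! ## The closed-form count for pair blocks -/

/-- **Pair blocks** (the point type `K₂ ⊔ ⋯ ⊔ K₂`, e.g. every crossing point of a (GEN) design in `E^{2r}` with `r`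
translates through it): `#PBT(M, q) = C(r, q) · 2^q` — `1, 6, 12, 8` for `q = 0, 1, 2, 3` at the triple point of `E⁶`. -/
theorem card_pbt_of_card_eq_two (r : ℕ) :
    ∀ {ι : Type} [Fintype ι] [DecidableEq ι] (B : Blocks ι n), Fintype.card ι = r → (∀ i, (B.S i).card = 2) →
      ∀ q : ℕ, Fintype.card (PBT B q) = r.choose q * 2 ^ q := by
  induction r with
  | zero =>
    intro ι _ _ B hr _ q
    haveI : IsEmpty ι := Fintype.card_eq_zero_iff.1 hr
    cases q with
    | zero => simp [Fintype.card_unique]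
    | succ k => simp [Fintype.card_eq_zero]
  | succ r ih =>
    intro ι _ _ B hr h2 q
    obtain ⟨i₀⟩ : Nonempty ι := Fintype.card_pos_iff.1 (by omega)
    have hcard : Fintype.card {i // i ≠ i₀} = r := by
      rw [Fintype.card_subtype, Finset.filter_ne', Finset.card_erase_of_mem (Finset.mem_univ _),
        Finset.card_univ, hr]
      rfl
    have ih' := ih (B.restrict (· ≠ i₀)) hcard (fun j => h2 j.1)
    cases q with
    | zero => rw [card_pbt_zero B i₀, ih' 0]; simp
    | succ k =>
      rw [card_pbt_succ B i₀ k, ih' (k + 1), ih' k, h2 i₀, Nat.choose_succ_succ', pow_succ]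
      ring



/-! ## The general closed form: elementary symmetric functions of the block weights -/

section Esymm

/-- The recursion of the elementary symmetric functions of a family along one index:
`e_{k+1}(w) = e_{k+1}(w|_{≠ i₀}) + w_{i₀} · e_k(w|_{≠ i₀})`. -/
theorem esymm_univ_succ {ι : Type} [Fintype ι] [DecidableEq ι] (w : ι → ℕ) (i₀ : ι) (k : ℕ) :
    ((univ : Finset ι).val.map w).esymm (k + 1) =
      ((univ : Finset {j // j ≠ i₀}).val.map fun j => w j.1).esymm (k + 1) +
        w i₀ * ((univ : Finset {j // j ≠ i₀}).val.map fun j => w j.1).esymm k := by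
  have h1 : (univ : Finset ι).val.map w =
      w i₀ ::ₘ ((univ : Finset {j // j ≠ i₀}).val.map fun j => w j.1) := by
    rw [← Multiset.map_univ_val_equiv (Equiv.optionSubtypeNe i₀), Multiset.map_map, univ_option]
    change Multiset.map _ (none ::ₘ (univ.val.map some)) = _
    rw [Multiset.map_cons, Multiset.map_map]
    rfl
  rw [h1]
  simp only [Multiset.esymm, Multiset.powersetCard_cons, Multiset.map_add, Multiset.sum_add, Multiset.map_map,
    Function.comp_def, Multiset.prod_cons]
  rw [Multiset.sum_map_mul_left]

/-- `e_0 = 1`. -/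
theorem esymm_univ_zero {ι : Type} [Fintype ι] (w : ι → ℕ) : ((univ : Finset ι).val.map w).esymm 0 = 1 := by
  simp [Multiset.esymm, Multiset.powersetCard_zero_left]

/-- `e_{k+1}` of the empty family is `0`. -/
theorem esymm_univ_succ_of_isEmpty {ι : Type} [Fintype ι] [IsEmpty ι] (w : ι → ℕ) (k : ℕ) :
    ((univ : Finset ι).val.map w).esymm (k + 1) = 0 := by
  simp [Multiset.esymm, Finset.univ_eq_empty]

/-- **`#PBT(M, q) = e_q(|S_1|(|S_1|−1), …, |S_r|(|S_r|−1))`**, the `q`-th elementary symmetric function of the block weights. -/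
theorem card_pbt_eq_esymm (r : ℕ) :
    ∀ {ι : Type} [Fintype ι] [DecidableEq ι] (B : Blocks ι n), Fintype.card ι = r → ∀ q : ℕ,
      Fintype.card (PBT B q) = ((univ : Finset ι).val.map fun i => (B.S i).card * ((B.S i).card - 1)).esymm q := by
  induction r with
  | zero =>
    intro ι _ _ B hr q
    haveI : IsEmpty ι := Fintype.card_eq_zero_iff.1 hr
    cases q with
    | zero => rw [esymm_univ_zero]; simp [Fintype.card_unique]
    | succ k => rw [esymm_univ_succ_of_isEmpty]; simp [Fintype.card_eq_zero]
  | succ r ih =>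
    intro ι _ _ B hr q
    obtain ⟨i₀⟩ : Nonempty ι := Fintype.card_pos_iff.1 (by omega)
    have hcard : Fintype.card {i // i ≠ i₀} = r := by
      rw [Fintype.card_subtype, Finset.filter_ne', Finset.card_erase_of_mem (Finset.mem_univ _),
        Finset.card_univ, hr]
      rfl
    have ih' := ih (B.restrict (· ≠ i₀)) hcard
    cases q with
    | zero => rw [card_pbt_zero B i₀, ih' 0, esymm_univ_zero, esymm_univ_zero]
    | succ k =>
      rw [card_pbt_succ B i₀ k, ih' (k + 1), ih' k,
        esymm_univ_succ (fun i => (B.S i).card * ((B.S i).card - 1)) i₀ k]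
      rfl

/-- **THE GENERAL COUNT: `#PBT(M, q) = Σ_{J ⊆ blocks, |J| = q} Π_{i ∈ J} |S_i|(|S_i| − 1)`** — the number of pieces
`R ⧸ J_τ` of `Ext^q_R(I_M, I_M)` (file XLIV); EXT-NOTE §6.B(c)'s «2^q per q-set of components from q distinct translates»
summed over the `Π_{i ∈ J} C(|S_i|, 2)` such q-sets. -/
theorem card_pbt {ι : Type} [Fintype ι] [DecidableEq ι] (B : Blocks ι n) (q : ℕ) :
    Fintype.card (PBT B q) = ∑ J ∈ (univ : Finset ι).powersetCard q, ∏ i ∈ J, (B.S i).card * ((B.S i).card - 1) := by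
  rw [card_pbt_eq_esymm (Fintype.card ι) B rfl q, Finset.esymm_map_val]

end Esymm

end Summit.Ventures.HSemireg.ObstructionLocus.BlockModel
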